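import Summits.BirchSwinnertonDyer.BirchSwinnertonDyer.Theorems.SylvesterTwoHeegnerIndexCoupledTelescopeStep
import HarnessLib

/-!
# The COUPLED Cassels–Tate telescope, VII: the DESCENDED LAGRANGIAN `D = r(D₀) ⊔ w·r(D₀)` — isotropy
# and coisotropy from a `ℚ`-Lagrangian through the projection formula (the algebra of hT's (T-L4))

Companion of `…Theorems.SylvesterTwoHeegnerIndexCoupledTelescope{Step,,Selmer,Count,TailFour,TailSeven,
Lifts}` (crux `UpperOffV0HSYPlus`, stmt-BirchSwinnertonDyer-19804, VARIANT M stubs `stub_tailFour` /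
`stub_tailSeven`).  The census theorems display (T-L4) per curve `X`: a bi-additive `ℚ/ℤ`-valued `B_X`
on `Ш(X_K)[2^∞]` and a COISOTROPIC `D_X` covered by the `𝒪`-span of the lifts; the telescope itself
needs the lifts `𝒪`-ISOTROPIC.  Memo two §59.1 (iii) / §64.5 SET-UP (McCallum p. 288 «choose a maximal
isotropic subgroup») builds `D_X := r(D₀) ⊔ w·r(D₀)` from a Lagrangian `D₀` of the `ℚ`-side
`M₀ = Ш(X/ℚ)[2^∞]` along the restriction `r : M₀ → M = Ш(X_K)[2^∞]`.  This file proves, ABSTRACTLY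
(any additive groups `M₀`, `M`, any bi-additive `B₀ : M₀ → M₀ → R`, `B : M → M → R`, any additive
`r : M₀ → M`, `w : M → M`), that `D_X` is

* `isotropic_closure_descent` — ISOTROPIC for `B`, and
* `coisotropic_closure_descent` — COISOTROPIC (`D^⊥ ≤ D`) for `B`,

GIVEN exactly: (CT-3′) the two `j = 0` consequences of the PROJECTION FORMULA `⟨res a, c⟩_K =
⟨a, cor c⟩_ℚ` (Fisher 2003 Prop. 2.16 / Morgan–Smith; planner D567 (3)/D568: «derived, not verbatim
print» until K-ty types `cor`) — `B (r a) (r b) = 2 • B₀ a b` and `B (r a) (w (r b)) = -(B₀ a b)`;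
the `𝒪`-BALANCE `B (w a) b = B a (-b - w b)` and `w (w b) = -b - w b` (k-ty1 (WRAP-CT) #24 p693884,
(WRAP-𝒪) p603310); the DESCENT surjectivity `∀ m, ∃ c d, m = r c + w (r d)` (LEMMA K0 structure form,
k-ty1/g19 p614631 `exists_descent_bijective`); `D₀` isotropic and coisotropic for `B₀`; and (for
coisotropy) `M₀` `2`-primary (a value killed by `3` and by a power of `2` vanishes).  So the rows'
(T-L4)/(hiso) leaves reduce to NAMED tree inputs + (CT-3′).
Theorem-only (no definition, no named fact); pure algebra; nothing asserted on 19804; BSD not claimed.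
Sources: McCallum 1991 (LMS LN 153) §5 p. 288; MEMO-bsd-cm-two §57.1, §59.1 (iii), §64.0/§64.5;
Fisher 2003 (J. reine angew.? — JNT) Prop. 2.16 as cited by the planner (D567 (3)).
-/

-- every Summits module is named `Summit.<Summit>.<Problem>…`: the duplicated component is by design
set_option linter.dupNamespace false
set_option autoImplicit false

open scoped Classical

namespace Summit.BirchSwinnertonDyer.BirchSwinnertonDyer.Theorems.SylvesterTwoCoupledTelescope

section Lagrangian

variable {M₀ M R : Type*} [AddCommGroup M₀] [AddCommGroup M] [AddCommGroup R]

/-- The four values of `B` on descended elements, from (CT-3′) and the `𝒪`-balance: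
`B (r c + w (r d)) (r a) = 2•B₀ c a - B₀ d a` and `B (r c + w (r d)) (w (r a)) = -(B₀ c a) + 2•B₀ d a`.
[folklore] -/
theorem pairing_descent_apply (B₀ : M₀ →+ M₀ →+ R) (B : M →+ M →+ R) (r : M₀ →+ M) (w : M →+ M)
    (hw : ∀ b, w (w b) = -b - w b) (hbal : ∀ a b, B (w a) b = B a (-b - w b))
    (hrr : ∀ a b, B (r a) (r b) = (2 : ℤ) • B₀ a b) (hrw : ∀ a b, B (r a) (w (r b)) = -(B₀ a b))
    (c d a : M₀) :
    B (r c + w (r d)) (r a) = (2 : ℤ) • B₀ c a - B₀ d a ∧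
      B (r c + w (r d)) (w (r a)) = -(B₀ c a) + (2 : ℤ) • B₀ d a := by
  constructor
  · rw [map_add, AddMonoidHom.add_apply, hrr, hbal, map_sub, map_neg, hrr, hrw]
    abel
  · rw [map_add, AddMonoidHom.add_apply, hrw, hbal, hw, show -w (r a) - (-r a - w (r a)) = r a by abel,
      hrr]

/-- **The descended Lagrangian is ISOTROPIC**: if `D₀ ≤ M₀` is isotropic for `B₀`, then the `𝒪`-span
`closure (r(D₀) ∪ w '' r(D₀))` is isotropic for `B` (memo two §59.1 (iii); LEMMA D Part II
`isotropic_sup_map_w` is the same statement with the vanishing `B(x, w y) = 0` as INPUT — here that input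
is DERIVED from (CT-3′)). [cite: McCallumLMS1991, §5 (p. 288)] -/
theorem isotropic_closure_descent (B₀ : M₀ →+ M₀ →+ R) (B : M →+ M →+ R) (r : M₀ →+ M) (w : M →+ M)
    (hw : ∀ b, w (w b) = -b - w b) (hbal : ∀ a b, B (w a) b = B a (-b - w b))
    (hrr : ∀ a b, B (r a) (r b) = (2 : ℤ) • B₀ a b) (hrw : ∀ a b, B (r a) (w (r b)) = -(B₀ a b))
    (D₀ : AddSubgroup M₀) (hiso : ∀ a ∈ D₀, ∀ b ∈ D₀, B₀ a b = 0) :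
    ∀ s ∈ AddSubgroup.closure ((r '' (D₀ : Set M₀)) ∪ w '' (r '' (D₀ : Set M₀))),
      ∀ t ∈ AddSubgroup.closure ((r '' (D₀ : Set M₀)) ∪ w '' (r '' (D₀ : Set M₀))), B s t = 0 := by
  -- every element of the span is `r c + w (r d)` with `c, d ∈ D₀`
  have hform : ∀ s ∈ AddSubgroup.closure ((r '' (D₀ : Set M₀)) ∪ w '' (r '' (D₀ : Set M₀))),
      ∃ c ∈ D₀, ∃ d ∈ D₀, s = r c + w (r d) := by
    intro s hs
    induction hs using AddSubgroup.closure_induction with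
    | mem u hu =>
      rcases hu with ⟨c, hc, rfl⟩ | ⟨_, ⟨d, hd, rfl⟩, rfl⟩
      · exact ⟨c, hc, 0, D₀.zero_mem, by simp⟩
      · exact ⟨0, D₀.zero_mem, d, hd, by simp⟩
    | zero => exact ⟨0, D₀.zero_mem, 0, D₀.zero_mem, by simp⟩
    | add u v _ _ hu hv =>
      obtain ⟨c, hc, d, hd, rfl⟩ := hu
      obtain ⟨c', hc', d', hd', rfl⟩ := hv
      exact ⟨c + c', add_mem hc hc', d + d', add_mem hd hd', by simp only [map_add]; abel⟩
    | neg u _ hu =>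
      obtain ⟨c, hc, d, hd, rfl⟩ := hu
      exact ⟨-c, neg_mem hc, -d, neg_mem hd, by simp only [map_neg]; abel⟩
  intro s hs t ht
  obtain ⟨c, hc, d, hd, rfl⟩ := hform s hs
  obtain ⟨c', hc', d', hd', rfl⟩ := hform t ht
  obtain ⟨h1, h2⟩ := pairing_descent_apply B₀ B r w hw hbal hrr hrw c d c'
  obtain ⟨h3, h4⟩ := pairing_descent_apply B₀ B r w hw hbal hrr hrw c d d'
  rw [map_add, h1, h4, hiso c hc c' hc', hiso d hd c' hc', hiso c hc d' hd', hiso d hd d' hd']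
  simp

/-- A value killed by `3` and by a power of `2` vanishes. [folklore] -/
theorem eq_zero_of_three_smul_of_two_pow_smul {v : R} (h3 : (3 : ℤ) • v = 0) {k : ℕ}
    (h2 : ((2 : ℤ) ^ k) • v = 0) : v = 0 := by
  -- `gcd(3, 2^k) = 1`
  have hcop : IsCoprime (3 : ℤ) ((2 : ℤ) ^ k) := by
    apply IsCoprime.pow_right
    exact (Int.isCoprime_iff_gcd_eq_one.mpr (by norm_num))
  obtain ⟨a, b, hab⟩ := hcop
  calc v = (1 : ℤ) • v := (one_smul ℤ v).symm
    _ = (a * 3 + b * 2 ^ k) • v := by rw [hab]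
    _ = 0 := by rw [add_smul, mul_smul, mul_smul, h3, h2, smul_zero, smul_zero, add_zero]

/-- **The descended Lagrangian is COISOTROPIC** (`D^⊥ ≤ D`): if every element of `M` is `r c + w (r d)`
(descent surjectivity, LEMMA K0), `M₀` is `2`-primary, and `D₀ ≤ M₀` is coisotropic for `B₀`
(`D₀^⊥ ≤ D₀`, a Lagrangian), then the `𝒪`-span `D = closure (r(D₀) ∪ w '' r(D₀))` satisfies `D^⊥ ≤ D`
for `B`: for `t = r c + w (r d) ⊥ D` and `a ∈ D₀` one gets `2B₀(c,a) - B₀(d,a) = 0` and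
`-B₀(c,a) + 2B₀(d,a) = 0`, hence `3B₀(c,a) = 0 = 3B₀(d,a)`, so `B₀(c,a) = B₀(d,a) = 0` (`2`-primary
values), i.e. `c, d ∈ D₀^⊥ ≤ D₀` (memo two §59.1 (iii) / §64.5 SET-UP; McCallum p. 288).
[cite: McCallumLMS1991, §5 (p. 288)] -/
theorem coisotropic_closure_descent (B₀ : M₀ →+ M₀ →+ R) (B : M →+ M →+ R) (r : M₀ →+ M) (w : M →+ M)
    (hw : ∀ b, w (w b) = -b - w b) (hbal : ∀ a b, B (w a) b = B a (-b - w b))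
    (hrr : ∀ a b, B (r a) (r b) = (2 : ℤ) • B₀ a b) (hrw : ∀ a b, B (r a) (w (r b)) = -(B₀ a b))
    (hsurj : ∀ m : M, ∃ c d : M₀, m = r c + w (r d))
    (hprim : ∀ c : M₀, ∃ k : ℕ, ((2 : ℤ) ^ k) • c = 0)
    (D₀ : AddSubgroup M₀) (hco : ∀ c, (∀ a ∈ D₀, B₀ c a = 0) → c ∈ D₀) :
    ∀ t, (∀ s ∈ AddSubgroup.closure ((r '' (D₀ : Set M₀)) ∪ w '' (r '' (D₀ : Set M₀))), B t s = 0) →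
      t ∈ AddSubgroup.closure ((r '' (D₀ : Set M₀)) ∪ w '' (r '' (D₀ : Set M₀))) := by
  intro t ht
  obtain ⟨c, d, rfl⟩ := hsurj t
  have hra : ∀ a ∈ D₀, r a ∈ AddSubgroup.closure ((r '' (D₀ : Set M₀)) ∪ w '' (r '' (D₀ : Set M₀))) :=
    fun a ha ↦ AddSubgroup.subset_closure (Set.mem_union_left _ ⟨a, ha, rfl⟩)
  have hwra : ∀ a ∈ D₀, w (r a) ∈
      AddSubgroup.closure ((r '' (D₀ : Set M₀)) ∪ w '' (r '' (D₀ : Set M₀))) :=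
    fun a ha ↦ AddSubgroup.subset_closure (Set.mem_union_right _ ⟨r a, ⟨a, ha, rfl⟩, rfl⟩)
  -- the two relations at every `a ∈ D₀`
  have hvals : ∀ a ∈ D₀, B₀ c a = 0 ∧ B₀ d a = 0 := by
    intro a ha
    obtain ⟨h1, h2⟩ := pairing_descent_apply B₀ B r w hw hbal hrr hrw c d a
    have e1 : (2 : ℤ) • B₀ c a - B₀ d a = 0 := by rw [← h1]; exact ht _ (hra a ha)
    have e2 : -(B₀ c a) + (2 : ℤ) • B₀ d a = 0 := by rw [← h2]; exact ht _ (hwra a ha)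
    have hd' : B₀ d a = (2 : ℤ) • B₀ c a := (sub_eq_zero.mp e1).symm
    have e3 : (3 : ℤ) • B₀ c a = 0 := by
      rw [hd', smul_smul] at e2
      have : -(B₀ c a) + (2 * 2 : ℤ) • B₀ c a = (3 : ℤ) • B₀ c a := by
        rw [show (2 * 2 : ℤ) = 1 + 3 by norm_num, add_smul, one_smul]; abel
      rwa [this] at e2
    obtain ⟨k, hk⟩ := hprim c
    have h2k : ((2 : ℤ) ^ k) • B₀ c a = 0 := by
      have h := congrArg (fun f : M₀ →+ R ↦ f a) (map_zsmul B₀ ((2 : ℤ) ^ k) c)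
      simp only [hk, map_zero, AddMonoidHom.zero_apply, AddMonoidHom.coe_smul, Pi.smul_apply] at h
      exact h.symm
    have hc0 : B₀ c a = 0 := eq_zero_of_three_smul_of_two_pow_smul e3 h2k
    exact ⟨hc0, by rw [hd', hc0, smul_zero]⟩
  have hc : c ∈ D₀ := hco c fun a ha ↦ (hvals a ha).1
  have hd : d ∈ D₀ := hco d fun a ha ↦ (hvals a ha).2
  exact add_mem (hra c hc) (hwra d hd)

end Lagrangian

end Summit.BirchSwinnertonDyer.BirchSwinnertonDyer.Theorems.SylvesterTwoCoupledTelescope
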